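import Summits.QuantumFields.BalabanUV.T4Continuum.Spine.NE1p.DressedSourceAnalyticSlotLetters

/-!
# T⁴ programme, spine estimate NE1′ (node O3b/H2) — THE REGENERATION IS LINEAR IN THE FAMILY'S CONTENT: the (B1a)-discharged
# (w5) END in the TOWER's `gen ≤ c·size` CURRENCY — the ALLOWANCE's Schwarz constant `c̄ = 2M∕ε` (free of the content `v`)
# reached from S33's holomorphy ENDs at the source radius `ε∕‖v‖`, for exp-linear families, (2.14)-cores, the substrate's slot
# activities and the Gaussian letters of record; the located comparison with S52's Cauchy form `M·σ∕(ε − σ)`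

Cell `pub-balaban`, sub-cell `t4`, BINDER-OWNERS row NE1′; NE1′ formalisation crew, unit `b2b-balaban-t4-ne1p-formalise-leaf-03`
(LEAF PROVER 03, generation 14); crew row S55 ∕ DAG N29zzzze of `t4/formal/NE1p/LEAVES.md` (INTENT + STAGED journal l.22689, BOOKED typer R-T139 l.22796; own-lineage
follower of S52 `DressedRegenerationOnCores` (p238661) and S33 `DressedSourceAnalyticOnCores` (p230131), in the owner's `DressedSmallFieldAllowance` (p218876) §3's currency).
ADDITIVE — imports S46 `Spine/NE1p/DressedSourceAnalyticSlotLetters` ONLY (→ S42 → S33 → N0r∕…∕N0j → `DressedSmallFieldSeries` →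
`DressedSmallFieldAllowance`; → S30 §1's block producers); THEOREMS ONLY (0 def, 0 `def … : Prop`, 0 cite); nothing restated.

WHY THIS FILE.  The tower's (w5) binder is `BookingLeaves.hreg : T.RegeneratesFromVar c (budgetGate …)` (`Spine/NE1p/DressedRoot`),
i.e. pv22∕`T4TrajectoryComparison`'s shape `gen b (k+1) ≤ c k · size b k` — what a step generates for a family is LINEAR IN THE
FAMILY'S SIZE with a per-step constant `c k` that must NOT depend on the family (END-B's `hrate : ρ k + C·c k ≤ ρ₁`, K- and μ-free
per R-t4r2-Q2).  The small-field (w5) END exists in the tree in TWO currencies: N0j's CAUCHY form `‖E₁ − E₀‖ ≤ M∕(ϱ − 1)`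
(`DressedSmallFieldPencil.regenPart_locE_le`, carried with (B1a) discharged by S33 §2 and S52 — strength pencil `h₀ + s • v` of radius
`ϱ`; with the natural radius `ϱ = ε∕σ`, `σ = ‖v‖` the content's size and `ε` the room left in the table ball, the constant
`M∕(ϱ − 1) = M·σ∕(ε − σ)` DEPENDS ON THE SIZE), and the owner's SCHWARZ form `‖E(1) − E(0)‖ ≤ (2M∕ε)·σ`
(`DressedSmallFieldAllowance.regen_le_of_slack`, whose constant `c̄ = 2M∕ε` is SIZE-FREE — the one §5's (w7) product
`locatedLargeness_eq` ∕ `locatedLargeness_le_of_small` consumes; appliers in the tree: `DressedSmallFieldSeries.regen_le_of_termwise`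
(abstract series) ONLY — N0j wrote the μ-part's Schwarz twin `muPart_locE_le_schwarz` «so the g25 allowance arithmetic applies verbatim
to the print-shaped `M`», not the regeneration's).  This file feeds `regen_le_of_slack` BY NAME with the holomorphy ∕ (2.41)-envelope
ENDs of S33 at the source radius `ε∕σ`, so the (B1a)-discharged regeneration END lands in the tower's linear currency with the
print-shaped `M = e·ν·c₁·K₀²·A·e^{−r₁ d(X₀)}`:
* §1 `regenPart_locE_le_linear_of_expLinear` (kernel; S33 §2 `analytic_and_bounded_locE_param_of_expLinear` ONCE at `P := ℂ`,
  `S := ball 0 (ε∕σ)` + `regen_le_of_slack` ONCE): abstract strength curve `hc : ℂ → Hist`, `0 < σ < ε`; conclusion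
  `‖E[act 1](X₀) − E[act 0](X₀)‖ ≤ 2·M∕ε·σ`.
* §2 `regenPart_locE_le_linear_of_coresAt_pencil_mass` (kernel; S33 §3 `analytic_and_bounded_locE_of_coresAt_pencil_mass` ONCE at the
  source radius `μ₁ := ε∕‖v‖` + `regen_le_of_slack` ONCE with `σ := ‖v‖`): pencil `h₀ + s • v`, `0 < ‖v‖ < ε`, room
  `‖h₀ − ctr.2‖ + ε ≤ RHist k` (the WHOLE disc of contents of size `< ε` about `h₀` lies in the table ball), `hact` on `‖s‖ < ε∕‖v‖`,
  (B3) `hM3` read at the table radius `‖h₀‖ + ε`; conclusion `≤ 2·M∕ε·‖v‖` — LINEAR IN THE CONTENT'S SIZE, constant free of `v`.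
* §3 `regenPart_locE_le_linear_of_actOfLetters` (kernel; §2 at the term index `Pol × J`, `hact` BY `rfl` — S33 §4's pattern).
* §4 `regenPart_locE_le_linear_of_coreLettersOf` (kernel; §3 ONCE at `ℓ := coreLettersOf … A` with S30 §1's block producers
  `margin_pos` ∕ `hN_coreLettersOf` ∕ `hq_coreLettersOf` — S46 §2's pattern).
* §5 LOCATED ARITHMETIC [arith]: `cauchyConst_eq` (`M∕(ε∕σ − 1) = M·σ∕(ε − σ)`: S52's constant at the natural radius),
  `cauchy_le_schwarz_iff` (for `M, σ > 0`, `σ < ε`: `M·σ∕(ε − σ) ≤ (2M∕ε)·σ ↔ 2σ ≤ ε` — S52's Cauchy form is the sharper one exactly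
  when the content fills at most HALF the room; the Schwarz form is the one that is linear with a size-free constant on the WHOLE
  room), `schwarz_le_cauchy_iff` (the converse half).

WHAT STAYS DISPLAYED (binders, by name; NOTHING instantiated on Bałaban's densities): as in S33 §3∕§4 ∕ S46 §2 — the room `hroom`,
the Gaussian letter blocks resp. (§4) the substrate's primitive per-factor scalar letter conditions + CENTRE CONDITIONS + `hbud`∕`hmq`,
`hO`∕`hH` (now at the ROOM `ε`), (B1b)'s residue `terms`∕`emb`∕`hscale`, the clause SHAPES, (B3) = `hM3` (G-ne9p2-5, UNPRINTED, shared
with NE9, a BINDER); NEW DISPLAYED scalars: the content's size bound `‖v‖ < ε` (resp. `0 < σ < ε`).  WHICH table is a booked family's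
content 𝐖 and which room `ε` print's clauses leave are the owner's READING (skeleton leaf L-R ∕ L-P; `DressedSmallFieldAllowance` §3∕§4's
words), not asserted here; (2.14) p. 15, (2.38) p. 20, (2.41) p. 21 of [Balaban1988RGII] are LOCI (TYPE∕CONTEXT) quoted in the
imported modules with their tags; no numeral of print enters.

HONEST FRAMING.  By-name composition over SHAPES: S33's (B1a)-discharged holomorphy∕envelope ENDs + the owner's Schwarz lemma
(`regen_le_of_slack`, Mathlib's `Complex.dist_le_div_mul_dist_of_mapsTo_ball` inside); `2M∕ε` and `M·σ∕(ε − σ)` are the two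
READINGS of the (w5) constant c̄ along the strength pencil (owner g31, journal l.21941; N0j ∕ S52's words) — (B1a) discharged at the
cores ∕ letters, (w5) NOT discharged on Bałaban's densities; whether `c̄ = 2M∕ε` with the print-shaped `M` meets END-B's
`hrate : ρ + C·c̄ ≤ ρ₁` is the (w7) arithmetic of `DressedSmallFieldAllowance` §5 over DISPLAYED scalars, untouched here; (B1b) ∕ (B3) ∕
(B5) NOT discharged; 0 binders instantiated on Bałaban's densities; no new inequality beyond [folklore] Schwarz; no wall item of NE1′
or NE5 moves; the NE1′ wall wording of record v1.8 (T4-DAG v48) — words, not kind — does NOT move; R-t4r2-Q2 NOT met; ABSOLUTE RULE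
honoured ([folklore] kernel lemmas only; no disputed step of the audited manuscripts enters as a fact).  NE1′ ⇐ the named binders —
NOT proved, NOT printed; spine PROVED 0∕9; count 9 unchanged.  Rung (B)+1 on ONE finite four-torus — NOT infinite volume, NOT a
mass gap, NOT OS on ℝ⁴, NOT Clay.  HONEST DEPENDENCY: continuum YM on T⁴ ⇐ BetaPertH ∧ nine spine estimates (0/9 proved); BetaPertH
⇐ (D1) ∧ (D4) ∧ CAP+tail; G-an2-4 gates asym, D1 and NE2/3/4.
-/

noncomputable section

namespace Summit.QuantumFields.BalabanUV.T4Continuum.NE1p.DressedRegenerationLinear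

open scoped BigOperators Matrix
open Metric Set MeasureTheory
open Literature.MathematicalPhysics.QuantumFieldTheory.Balaban1983to89
open Literature.MathematicalPhysics.QuantumFieldTheory.Balaban1983to89.T4OutputRate (Carriers)
open Literature.MathematicalPhysics.QuantumFieldTheory.Balaban1983to89.B13Resummation (locE Geometry)
open Literature.MathematicalPhysics.QuantumFieldTheory.Balaban1983to89.B5Prop11Lower (nsq)
open Literature.MathematicalPhysics.QuantumFieldTheory.Balaban1983to89.T4InputCauchyRateTermwise (TermHistExpLinear)
open Summit.QuantumFields.BalabanUV.T4Continuum.B13HistMeasurable (MeasPotFrame B13HistM)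
open Summit.QuantumFields.BalabanUV.T4Continuum.B13TermParamGaussianBi (BiCore)
open Summit.QuantumFields.BalabanUV.T4Continuum.SubstrateTwoRunsDriven (DrivenRuns)
open Summit.QuantumFields.BalabanUV.T4Continuum.SubstrateActivities (CoreLetters coreOf actOfLetters)
open Summit.QuantumFields.BalabanUV.T4Continuum.SubstrateGaussianLetters (gaussC linForm)
open Summit.QuantumFields.BalabanUV.T4Continuum.SubstrateGaussianLettersBall (detBudget)
open Summit.QuantumFields.BalabanUV.T4Continuum.SubstrateSlotsOfRecord (ActLetters coreLettersOf)
open Summit.QuantumFields.BalabanUV.T4Continuum.NE1p.DressedSmallFieldAllowance (regen_le_of_slack)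
open Summit.QuantumFields.BalabanUV.T4Continuum.NE1p.DressedSmallFieldOnCoresSlotLetters (margin_pos hN_coreLettersOf
  hq_coreLettersOf)
open Summit.QuantumFields.BalabanUV.T4Continuum.NE1p.DressedSourceAnalyticOnCores (analytic_and_bounded_locE_param_of_expLinear
  analytic_and_bounded_locE_of_coresAt_pencil_mass)

/-! ## §1 EXP-LINEAR FAMILIES ALONG AN ABSTRACT STRENGTH CURVE: the Schwarz currency `2·M∕ε·σ` -/

section ExpLinear
variable {C : Carriers} {Op Hist : Type*} [NormedAddCommGroup Hist] [NormedSpace ℂ Hist] {ι : Type*}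
  {K : ℕ → (ℕ → ℝ) → C.BgB → Set (Op × Hist)} {T : ℕ → ι → Op → Hist → C.Dom → ℂ}
  {W : Set (ℕ → ℝ)} {α : ℕ → ι → Type*} [∀ k i, MeasurableSpace (α k i)] {μ : ∀ k i, Op → C.Dom → Measure (α k i)}
  {Φ : ∀ k i, Op → C.Dom → α k i → ℂ} {Λ : ∀ k i, Op → C.Dom → α k i → (Hist →L[ℂ] ℂ)}
variable (D : LocDomainSys) {Cube : Type} [DecidableEq Cube] (G : Geometry D Cube)

open Classical in
/-- **THE (w5) REGENERATION CONSTANT IN THE SCHWARZ ∕ TOWER CURRENCY, (B1a) DISCHARGED** (kernel; S33 §2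
`analytic_and_bounded_locE_param_of_expLinear` ONCE at `P := ℂ`, `S := ball 0 (ε∕σ)` for the holomorphy of `s ↦ E[act s](X₀)` and its
(2.41) envelope `M = e·ν·c₁·K₀²·A·e^{−r₁ d(X₀)}` on the strength disc, then the owner's `DressedSmallFieldAllowance.regen_le_of_slack` ONCE):
for a strength curve `hc : ℂ → Hist` holomorphic on `‖s‖ < ε∕σ` keeping `(o, hc s)` in the class, `0 < σ < ε`,
`‖E[act 1](X₀) − E[act 0](X₀)‖ ≤ 2·M∕ε·σ` — LINEAR in `σ` with the constant `2M∕ε` free of `σ`. [folklore] -/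
theorem regenPart_locE_le_linear_of_expLinear (hexp : TermHistExpLinear K T W μ Φ Λ) {k : ℕ} {g : ℕ → ℝ} (hg : g ∈ W)
    {U : C.BgB} {o : Op} {hc : ℂ → Hist} {σ ε R₀ : ℝ} (hσ : 0 < σ) (hσε : σ < ε)
    (hcurve : DifferentiableOn ℂ hc (ball (0 : ℂ) (ε / σ)))
    (hK : ∀ s ∈ ball (0 : ℂ) (ε / σ), (o, hc s) ∈ K k g U) (hR : ∀ s ∈ ball (0 : ℂ) (ε / σ), ‖hc s‖ ≤ R₀)
    {emb : D.Dom → C.Dom} (hscale : ∀ Z, C.scale (emb Z) = k) {terms : D.Dom → Finset ι} {act : ℂ → D.Dom → ℂ}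
    (hact : ∀ s ∈ ball (0 : ℂ) (ε / σ), ∀ Z, act s Z = ∑ i ∈ terms Z, T k i o (hc s) (emb Z)) {N : D.Dom → ι → ℝ}
    (hN0 : ∀ Z i, 0 ≤ N Z i) (hN : ∀ Z, ∀ i ∈ terms Z, ∀ᵐ a ∂μ k i o (emb Z), ‖Λ k i o (emb Z) a‖ ≤ N Z i)
    {A R r₁ b₅ : ℝ} {X₀ : D.Dom} (hA : 0 ≤ A) (hr₁ : 0 ≤ r₁) (hb : r₁ * 5 ≤ b₅)
    (hrate : r₁ + 2 * G.κ₀ + 2 ≤ R) (hsmall : A * Real.exp (b₅ + 1) * G.K₀ * G.ν * G.c₁ ≤ 1) (hL3 : ∀ Z, G.cubes Z ⊆ G.cubes X₀ →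
      ∑ i ∈ terms Z, (∫ a, ‖Φ k i o (emb Z) a‖ ∂μ k i o (emb Z)) * Real.exp (N Z i * R₀) ≤ A * Real.exp (-(R * D.dj Z))) :
    ‖locE G.ι G.cubes (act 1) (G.cubes X₀) - locE G.ι G.cubes (act 0) (G.cubes X₀)‖ ≤
      2 * (Real.exp 1 * G.ν * G.c₁ * G.K₀ ^ 2 * A * Real.exp (-(r₁ * D.dj X₀))) / ε * σ := by
  obtain ⟨hd, hM⟩ := analytic_and_bounded_locE_param_of_expLinear D G hexp hg isOpen_ball hcurve hK hR hscale hact hN0 hN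
    hA hr₁ hb hrate hsmall hL3
  exact regen_le_of_slack (E := fun s => locE G.ι G.cubes (act s) (G.cubes X₀)) hσ hσε hd hM

end ExpLinear

/-! ## §2 CORES WITH TERM-DEPENDENT POLYMER FAMILIES: pencil `h₀ + s • v`, source radius `ε∕‖v‖`, linear in `‖v‖` -/

section Dep
variable {C : Carriers} {P : MeasPotFrame C} {Op : Type*} [NormedAddCommGroup Op] [NormedSpace ℂ Op] {ι : Type*}
  {𝒴 : ℕ → ι → Type*} {dom : ∀ k i, 𝒴 k i → C.Dom} {β : ℕ → ι → Type*} [∀ k i, MeasurableSpace (β k i)]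
  {α : ℕ → ι → Type*} [∀ k i, NormedAddCommGroup (α k i)] [∀ k i, InnerProductSpace ℝ (α k i)]
  [∀ k i, FiniteDimensional ℝ (α k i)] [∀ k i, MeasurableSpace (α k i)] [∀ k i, BorelSpace (α k i)]
variable (D : LocDomainSys) {Cube : Type} [DecidableEq Cube] (G : Geometry D Cube)

open Classical in
/-- **THE REGENERATION IS LINEAR IN THE CONTENT'S SIZE — CORES WITH TERM-DEPENDENT POLYMER FAMILIES, (B1a) DISCHARGED, (B3) AS A
LETTER BUDGET** (kernel; S33 §3 `analytic_and_bounded_locE_of_coresAt_pencil_mass` ONCE at the source radius `μ₁ := ε∕‖v‖` — then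
`μ₁·‖v‖ = ε` — and `regen_le_of_slack` ONCE with `σ := ‖v‖`).  Binders = S33 §3's with the radius replaced by the ROOM: `0 < ‖v‖ < ε`,
`hH : ‖h₀ − (ctr k g U).2‖ + ε ≤ RHist k`, `hact` on `‖s‖ < ε∕‖v‖`, `hM3` at the table radius `‖h₀‖ + ε`.  Conclusion:
`‖E[act 1](X₀) − E[act 0](X₀)‖ ≤ 2·(e·ν·c₁·K₀²·A·e^{−r₁ d(X₀)})∕ε·‖v‖` — the tower's `gen ≤ c·size` currency with `c = 2M∕ε` free of
the content `v`. [folklore] -/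
theorem regenPart_locE_le_linear_of_coresAt_pencil_mass {W : Set (ℕ → ℝ)}
    {ctr : ℕ → (ℕ → ℝ) → C.BgB → Op × B13HistM P} {ROp RHist R' : ℕ → ℝ}
    (𝔊 : ∀ k i, C.Dom → BiCore P (dom k i) Op (β k i) (α k i)) {mq bq N₀ : ℕ → ι → C.Dom → ℝ} (hroom : ∀ k, ROp k < R' k)
    (hm : ∀ k, ∀ g ∈ W, ∀ (U : C.BgB) (X : C.Dom), C.scale X = k → ∀ i, 0 < mq k i X)
    (hN : ∀ k, ∀ g ∈ W, ∀ (U : C.BgB) (X : C.Dom), C.scale X = k → ∀ i,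
      (∀ o ∈ ball (ctr k g U).1 (R' k), AEStronglyMeasurable ((𝔊 k i X).N o) (𝔊 k i X).lam) ∧
      (∀ p, DifferentiableOn ℂ (fun o => (𝔊 k i X).N o p) (ball (ctr k g U).1 (R' k))) ∧
      (∀ o ∈ ball (ctr k g U).1 (R' k), ∀ p, ‖(𝔊 k i X).N o p‖ ≤ N₀ k i X))
    (hq : ∀ k, ∀ g ∈ W, ∀ (U : C.BgB) (X : C.Dom), C.scale X = k → ∀ i,
      (∀ o ∈ ball (ctr k g U).1 (R' k),
        AEStronglyMeasurable (Function.uncurry ((𝔊 k i X).q o)) ((𝔊 k i X).lam.prod volume)) ∧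
      (∀ p v, DifferentiableOn ℂ (fun o => (𝔊 k i X).q o p v) (ball (ctr k g U).1 (R' k))) ∧
      (∀ o ∈ ball (ctr k g U).1 (R' k), ∀ p v, mq k i X * ‖v‖ ^ 2 - bq k i X ≤ ((𝔊 k i X).q o p v).re))
    {k : ℕ} {g : ℕ → ℝ} (hg : g ∈ W) {U : C.BgB} {o : Op} {h₀ v : B13HistM P} {ε : ℝ} (hv : 0 < ‖v‖) (hvε : ‖v‖ < ε)
    (hO : ‖o - (ctr k g U).1‖ ≤ ROp k) (hH : ‖h₀ - (ctr k g U).2‖ + ε ≤ RHist k)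
    {emb : D.Dom → C.Dom} (hscale : ∀ Z, C.scale (emb Z) = k) {terms : D.Dom → Finset ι} {act : ℂ → D.Dom → ℂ}
    (hact : ∀ s ∈ ball (0 : ℂ) (ε / ‖v‖), ∀ Z, act s Z = ∑ i ∈ terms Z, (𝔊 k i (emb Z)).termAt o (h₀ + s • v))
    {A R r₁ b₅ : ℝ} {X₀ : D.Dom} (hA : 0 ≤ A) (hr₁ : 0 ≤ r₁) (hb : r₁ * 5 ≤ b₅)
    (hrate : r₁ + 2 * G.κ₀ + 2 ≤ R) (hsmall : A * Real.exp (b₅ + 1) * G.K₀ * G.ν * G.c₁ ≤ 1) (hM3 : ∀ Z, G.cubes Z ⊆ G.cubes X₀ →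
      ∑ i ∈ terms Z, (𝔊 k i (emb Z)).lam.real univ * ((𝔊 k i (emb Z)).wB * N₀ k i (emb Z) *
          Real.exp (bq k i (emb Z))) * (Real.pi / (mq k i (emb Z) / 2)) ^ (Module.finrank ℝ (α k i) / 2 : ℝ) *
        Real.exp ((𝔊 k i (emb Z)).N₁ * (‖h₀‖ + ε)) ≤ A * Real.exp (-(R * D.dj Z))) :
    ‖locE G.ι G.cubes (act 1) (G.cubes X₀) - locE G.ι G.cubes (act 0) (G.cubes X₀)‖ ≤
      2 * (Real.exp 1 * G.ν * G.c₁ * G.K₀ ^ 2 * A * Real.exp (-(r₁ * D.dj X₀))) / ε * ‖v‖ := by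
  have hε : ε / ‖v‖ * ‖v‖ = ε := div_mul_cancel₀ ε hv.ne'
  rw [← hε] at hH hM3
  obtain ⟨hd, hM⟩ := analytic_and_bounded_locE_of_coresAt_pencil_mass D G 𝔊 hroom hm hN hq hg hO hH hscale hact hA hr₁ hb
    hrate hsmall hM3
  exact regen_le_of_slack (E := fun s => locE G.ι G.cubes (act s) (G.cubes X₀)) hv hvε hd hM

end Dep

/-! ## §3 THE SUBSTRATE'S SLOT ACTIVITIES `actOfLetters ℓ` — `hact` BY `rfl` -/

section Slot
variable {C : Carriers} (P : MeasPotFrame C) (Op : Type*) [NormedAddCommGroup Op] [NormedSpace ℂ Op] {Pol J : Type*}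
  (𝒴 : Pol → J → Type) [∀ Z j, Fintype (𝒴 Z j)] (dom : ∀ Z j, 𝒴 Z j → C.Dom)
  (Jc : Pol → J → Type) [∀ Z j, Fintype (Jc Z j)]
  (V : Pol → J → Type) [∀ Z j, NormedAddCommGroup (V Z j)] [∀ Z j, InnerProductSpace ℝ (V Z j)]
  [∀ Z j, MeasurableSpace (V Z j)] [∀ Z j, BorelSpace (V Z j)] [∀ Z j, FiniteDimensional ℝ (V Z j)]
variable (D : LocDomainSys) {Cube : Type} [DecidableEq Cube] (G : Geometry D Cube)

open Classical in
/-- **THE REGENERATION IS LINEAR IN THE CONTENT'S SIZE — THE SLOT ACTIVITIES** (kernel; §2 at the term index `Pol × J`,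
`𝔊 k p X := coreOf ℓ p.1 p.2`, `hact` BY `rfl`).  Conclusion: `‖E[Σ actOfLetters … o (h₀ + v)](X₀) − E[Σ actOfLetters … o h₀](X₀)‖
≤ 2·M∕ε·‖v‖`, written LITERALLY at `(1 : ℂ) • v` ∕ `(0 : ℂ) • v`. [folklore] -/
theorem regenPart_locE_le_linear_of_actOfLetters {W : Set (ℕ → ℝ)} {ctr : ℕ → (ℕ → ℝ) → C.BgB → Op × B13HistM P}
    {ROp RHist R' : ℕ → ℝ} (ℓ : ∀ Z j, CoreLetters P Op 𝒴 dom Jc V Z j) {mq bq N₀ : ℕ → Pol × J → C.Dom → ℝ}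
    (hroom : ∀ k, ROp k < R' k) (hm : ∀ k, ∀ g ∈ W, ∀ (U : C.BgB) (X : C.Dom), C.scale X = k → ∀ p, 0 < mq k p X)
    (hN : ∀ k, ∀ g ∈ W, ∀ (U : C.BgB) (X : C.Dom), C.scale X = k → ∀ p : Pol × J,
      (∀ o ∈ ball (ctr k g U).1 (R' k),
        AEStronglyMeasurable ((ℓ p.1 p.2).N o) (coreOf P Op 𝒴 dom Jc V ℓ p.1 p.2).lam) ∧
      (∀ a, DifferentiableOn ℂ (fun o => (ℓ p.1 p.2).N o a) (ball (ctr k g U).1 (R' k))) ∧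
      (∀ o ∈ ball (ctr k g U).1 (R' k), ∀ a, ‖(ℓ p.1 p.2).N o a‖ ≤ N₀ k p X))
    (hq : ∀ k, ∀ g ∈ W, ∀ (U : C.BgB) (X : C.Dom), C.scale X = k → ∀ p : Pol × J,
      (∀ o ∈ ball (ctr k g U).1 (R' k),
        AEStronglyMeasurable (Function.uncurry ((ℓ p.1 p.2).q o))
          ((coreOf P Op 𝒴 dom Jc V ℓ p.1 p.2).lam.prod volume)) ∧
      (∀ a v, DifferentiableOn ℂ (fun o => (ℓ p.1 p.2).q o a v) (ball (ctr k g U).1 (R' k))) ∧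
      (∀ o ∈ ball (ctr k g U).1 (R' k), ∀ a v, mq k p X * ‖v‖ ^ 2 - bq k p X ≤ ((ℓ p.1 p.2).q o a v).re))
    {k : ℕ} {g : ℕ → ℝ} (hg : g ∈ W) {U : C.BgB} {o : Op} {h₀ v : B13HistM P} {ε : ℝ} (hv : 0 < ‖v‖) (hvε : ‖v‖ < ε)
    (hO : ‖o - (ctr k g U).1‖ ≤ ROp k) (hH : ‖h₀ - (ctr k g U).2‖ + ε ≤ RHist k)
    {emb : D.Dom → C.Dom} (hscale : ∀ Z, C.scale (emb Z) = k) (terms : D.Dom → Finset (Pol × J))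
    {A R r₁ b₅ : ℝ} {X₀ : D.Dom} (hA : 0 ≤ A) (hr₁ : 0 ≤ r₁) (hb : r₁ * 5 ≤ b₅)
    (hrate : r₁ + 2 * G.κ₀ + 2 ≤ R) (hsmall : A * Real.exp (b₅ + 1) * G.K₀ * G.ν * G.c₁ ≤ 1) (hM3 : ∀ Z, G.cubes Z ⊆ G.cubes X₀ →
      ∑ p ∈ terms Z, (coreOf P Op 𝒴 dom Jc V ℓ p.1 p.2).lam.real univ *
          ((coreOf P Op 𝒴 dom Jc V ℓ p.1 p.2).wB * N₀ k p (emb Z) * Real.exp (bq k p (emb Z))) *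
          (Real.pi / (mq k p (emb Z) / 2)) ^ (Module.finrank ℝ (V p.1 p.2) / 2 : ℝ) *
        Real.exp ((coreOf P Op 𝒴 dom Jc V ℓ p.1 p.2).N₁ * (‖h₀‖ + ε)) ≤ A * Real.exp (-(R * D.dj Z))) :
    ‖locE G.ι G.cubes (fun Z => ∑ p ∈ terms Z, actOfLetters P Op 𝒴 dom Jc V ℓ p.1 p.2 o (h₀ + (1 : ℂ) • v)) (G.cubes X₀) -
        locE G.ι G.cubes (fun Z => ∑ p ∈ terms Z, actOfLetters P Op 𝒴 dom Jc V ℓ p.1 p.2 o (h₀ + (0 : ℂ) • v)) (G.cubes X₀)‖ ≤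
      2 * (Real.exp 1 * G.ν * G.c₁ * G.K₀ ^ 2 * A * Real.exp (-(r₁ * D.dj X₀))) / ε * ‖v‖ :=
  regenPart_locE_le_linear_of_coresAt_pencil_mass D G (ι := Pol × J)
    (fun (_ : ℕ) (p : Pol × J) (_ : C.Dom) => coreOf P Op 𝒴 dom Jc V ℓ p.1 p.2) hroom hm hN hq hg hv hvε hO hH hscale
    (terms := terms) (act := fun s Z => ∑ p ∈ terms Z, actOfLetters P Op 𝒴 dom Jc V ℓ p.1 p.2 o (h₀ + s • v))
    (fun _ _ _ => rfl) hA hr₁ hb hrate hsmall hM3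

end Slot

/-! ## §4 THE GAUSSIAN LETTERS OF RECORD `coreLettersOf A`, N0r's operator-letter blocks DISCHARGED by S30 §1 -/

section CoreLettersOf

variable {G : Type} [GaugeGroup G] (D : DrivenRuns G) (P : MeasPotFrame D.carriers)
variable (Op : Type) [NormedAddCommGroup Op] [NormedSpace ℂ Op] {J : Type}
  (𝒵 : D.carriers.Dom → J → Type) [∀ Z j, Fintype (𝒵 Z j)] (dom : ∀ Z j, 𝒵 Z j → D.carriers.Dom)
  (Jc : D.carriers.Dom → J → Type) [∀ Z j, Fintype (Jc Z j)]
  (V : D.carriers.Dom → J → Type) [∀ Z j, NormedAddCommGroup (V Z j)] [∀ Z j, InnerProductSpace ℝ (V Z j)]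
  [∀ Z j, MeasurableSpace (V Z j)] [∀ Z j, BorelSpace (V Z j)] [∀ Z j, FiniteDimensional ℝ (V Z j)]
  (mI : D.carriers.Dom → J → Type) [∀ Z j, Fintype (mI Z j)] [∀ Z j, DecidableEq (mI Z j)]
variable (𝔇 : LocDomainSys) {Cube : Type} [DecidableEq Cube] (Ge : Geometry 𝔇 Cube)

open Classical in
/-- **THE REGENERATION IS LINEAR IN THE CONTENT'S SIZE — AT THE CORE LETTERS OF RECORD, OPERATOR LETTERS DISCHARGED** (kernel; §3
ONCE BY NAME at `ℓ := coreLettersOf D P Op 𝒵 dom Jc V mI A` with S46 §2's letters `(mq, bq, N₀)` and S30 §1's block producers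
`margin_pos` ∕ `hN_coreLettersOf` ∕ `hq_coreLettersOf`).  Binders = S52-A §3's with [`ϱ`, `hϱ`] replaced by the room data [`ε`, `hv`,
`hvε`] (`hH` at `ε`, `hact` on `‖s‖ < ε∕‖v‖`, `hM3` at `‖h₀‖ + ε`).  Conclusion `≤ 2·M′∕ε·‖v‖`, `M′ = e·ν·c₁·K₀²·A′·e^{−r₁ d(X₀)}`.
[folklore] -/
theorem regenPart_locE_le_linear_of_coreLettersOf {W : Set (ℕ → ℝ)} {ctr : ℕ → (ℕ → ℝ) → D.carriers.BgB → Op × B13HistM P}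
    {ROp RHist R' : ℕ → ℝ} (A : ∀ Z j, ActLetters D P Op 𝒵 dom Jc V mI Z j) {β₀ ϑ d₀ γ : D.carriers.Dom → J → ℝ}
    (hroom : ∀ k, ROp k < R' k) (hR' : ∀ k, 0 ≤ R' k)
    (hbase : ∀ Z j ii jj, Measurable fun a => (A Z j).base a ii jj)
    (hrdm : ∀ Z j ii jj (o' : Op), Measurable fun a => (A Z j).rd a ii jj o')
    (hβ₀ : ∀ Z j, 0 ≤ β₀ Z j) (hd₀ : ∀ Z j, 0 < d₀ Z j)
    (hrd : ∀ Z j a ii jj, ‖(A Z j).rd a ii jj‖ ≤ ϑ Z j)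
    (hctr : ∀ k, ∀ g ∈ W, ∀ (U : D.carriers.BgB) (Z : D.carriers.Dom) (j : J) (a : (Jc Z j ⊕ 𝒵 Z j) → ℝ × ℝ),
      (∀ ii jj, ‖linForm (A Z j).base (A Z j).rd (ctr k g U).1 a ii jj‖ ≤ β₀ Z j) ∧
      ((linForm (A Z j).base (A Z j).rd (ctr k g U).1 a).det).im = 0 ∧ d₀ Z j ≤ ((linForm (A Z j).base (A Z j).rd (ctr k g U).1 a).det).re ∧
      (∀ x : mI Z j → ℂ, γ Z j * nsq x ≤ (star x ⬝ᵥ (linForm (A Z j).base (A Z j).rd (ctr k g U).1 a *ᵥ x)).re))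
    (hbud : ∀ k Z j, detBudget (Fintype.card (mI Z j)) (β₀ Z j) (ϑ Z j) (R' k) < d₀ Z j)
    (hmq : ∀ k Z j, Fintype.card (mI Z j) * ϑ Z j * R' k < γ Z j)
    {k : ℕ} {g : ℕ → ℝ} (hg : g ∈ W) {U : D.carriers.BgB} {o : Op} {h₀ v : B13HistM P} {ε : ℝ} (hv : 0 < ‖v‖) (hvε : ‖v‖ < ε)
    (hO : ‖o - (ctr k g U).1‖ ≤ ROp k) (hH : ‖h₀ - (ctr k g U).2‖ + ε ≤ RHist k)
    {emb : 𝔇.Dom → D.carriers.Dom} (hscale : ∀ Z, D.carriers.scale (emb Z) = k)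
    (terms : 𝔇.Dom → Finset (D.carriers.Dom × J))
    {A' R r₁ b₅ : ℝ} {X₀ : 𝔇.Dom} (hA : 0 ≤ A') (hr₁ : 0 ≤ r₁) (hb : r₁ * 5 ≤ b₅)
    (hrate : r₁ + 2 * Ge.κ₀ + 2 ≤ R) (hsmall : A' * Real.exp (b₅ + 1) * Ge.K₀ * Ge.ν * Ge.c₁ ≤ 1)
    (hM3 : ∀ Z, Ge.cubes Z ⊆ Ge.cubes X₀ →
      ∑ p ∈ terms Z, (coreOf P Op 𝒵 dom Jc V (coreLettersOf D P Op 𝒵 dom Jc V mI A) p.1 p.2).lam.real univ *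
          ((coreOf P Op 𝒵 dom Jc V (coreLettersOf D P Op 𝒵 dom Jc V mI A) p.1 p.2).wB *
              (gaussC (mI p.1 p.2) * Real.sqrt (max 1 ((Fintype.card (mI p.1 p.2)).factorial *
                β₀ p.1 p.2 ^ Fintype.card (mI p.1 p.2) + d₀ p.1 p.2))) * Real.exp 0) *
          (Real.pi / ((γ p.1 p.2 - Fintype.card (mI p.1 p.2) * ϑ p.1 p.2 * R' k) / 2 / 2)) ^ (Module.finrank ℝ (V p.1 p.2) / 2 : ℝ) *
        Real.exp ((coreOf P Op 𝒵 dom Jc V (coreLettersOf D P Op 𝒵 dom Jc V mI A) p.1 p.2).N₁ * (‖h₀‖ + ε)) ≤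
        A' * Real.exp (-(R * 𝔇.dj Z))) :
    ‖locE Ge.ι Ge.cubes (fun Z => ∑ p ∈ terms Z,
          actOfLetters P Op 𝒵 dom Jc V (coreLettersOf D P Op 𝒵 dom Jc V mI A) p.1 p.2 o (h₀ + (1 : ℂ) • v)) (Ge.cubes X₀) -
        locE Ge.ι Ge.cubes (fun Z => ∑ p ∈ terms Z,
          actOfLetters P Op 𝒵 dom Jc V (coreLettersOf D P Op 𝒵 dom Jc V mI A) p.1 p.2 o (h₀ + (0 : ℂ) • v)) (Ge.cubes X₀)‖ ≤
      2 * (Real.exp 1 * Ge.ν * Ge.c₁ * Ge.K₀ ^ 2 * A' * Real.exp (-(r₁ * 𝔇.dj X₀))) / ε * ‖v‖ :=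
  regenPart_locE_le_linear_of_actOfLetters P Op 𝒵 dom Jc V 𝔇 Ge (coreLettersOf D P Op 𝒵 dom Jc V mI A)
    (mq := fun k p _ => (γ p.1 p.2 - Fintype.card (mI p.1 p.2) * ϑ p.1 p.2 * R' k) / 2) (bq := fun _ _ _ => 0)
    (N₀ := fun _ p _ => gaussC (mI p.1 p.2) *
      Real.sqrt (max 1 ((Fintype.card (mI p.1 p.2)).factorial * β₀ p.1 p.2 ^ Fintype.card (mI p.1 p.2) + d₀ p.1 p.2)))
    hroom (margin_pos D mI hmq) (hN_coreLettersOf D P Op 𝒵 dom Jc V mI A hR' hbase hrdm hβ₀ hd₀ hrd hctr hbud)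
    (hq_coreLettersOf D P Op 𝒵 dom Jc V mI A hbase hrdm hrd hctr) hg hv hvε hO hH hscale terms hA hr₁ hb hrate hsmall hM3

end CoreLettersOf

/-! ## §5 LOCATED ARITHMETIC: S52's Cauchy constant at the natural radius, and which currency is sharper where -/

section Arith

/-- **S52's CONSTANT AT THE NATURAL RADIUS** [arith]: with `ϱ = ε∕σ` (`0 < σ < ε`), `M∕(ϱ − 1) = M·σ∕(ε − σ)` — N0j's
«print-shaped `M·σ∕(ε − σ)`». -/
theorem cauchyConst_eq {M σ ε : ℝ} (hσ : 0 < σ) (hσε : σ < ε) : M / (ε / σ - 1) = M * σ / (ε - σ) := by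
  have hσ0 : σ ≠ 0 := hσ.ne'
  have h1 : ε - σ ≠ 0 := (sub_pos.2 hσε).ne'
  rw [div_sub_one hσ0, div_div_eq_mul_div]

/-- **WHICH CURRENCY IS SHARPER** [arith]: for `M, σ > 0` and `σ < ε`, S52's Cauchy bound `M·σ∕(ε − σ)` is at most the Schwarz ∕
tower bound `(2M∕ε)·σ` IFF the content fills at most half the room, `2σ ≤ ε`. -/
theorem cauchy_le_schwarz_iff {M σ ε : ℝ} (hM : 0 < M) (hσ : 0 < σ) (hσε : σ < ε) :
    M * σ / (ε - σ) ≤ 2 * M / ε * σ ↔ 2 * σ ≤ ε := by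
  have hε : 0 < ε := hσ.trans hσε
  have h1 : 0 < ε - σ := sub_pos.2 hσε
  have hMσ : 0 < M * σ := mul_pos hM hσ
  rw [show 2 * M / ε * σ = 2 * (M * σ) / ε by ring, div_le_div_iff₀ h1 hε]
  constructor
  · intro h; nlinarith
  · intro h; nlinarith

/-- … and the Schwarz ∕ tower bound is at most S52's Cauchy bound IFF `ε ≤ 2σ`. [arith] -/
theorem schwarz_le_cauchy_iff {M σ ε : ℝ} (hM : 0 < M) (hσ : 0 < σ) (hσε : σ < ε) :
    2 * M / ε * σ ≤ M * σ / (ε - σ) ↔ ε ≤ 2 * σ := by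
  have hε : 0 < ε := hσ.trans hσε
  have h1 : 0 < ε - σ := sub_pos.2 hσε
  have hMσ : 0 < M * σ := mul_pos hM hσ
  rw [show 2 * M / ε * σ = 2 * (M * σ) / ε by ring, div_le_div_iff₀ hε h1]
  constructor
  · intro h; nlinarith
  · intro h; nlinarith

/-- Decided instance: with room `ε = 1` and unit envelope `M = 1`, a content of size `σ = 1∕4` regenerates at most `1∕3` (Cauchy)
resp. `1∕2` (Schwarz) — the Cauchy currency is sharper; at `σ = 3∕4` it is `3` resp. `3∕2` — the Schwarz currency is sharper. -/
example : (1 : ℝ) * (1 / 4) / (1 - 1 / 4) = 1 / 3 ∧ 2 * (1 : ℝ) / 1 * (1 / 4) = 1 / 2 ∧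
    (1 : ℝ) * (3 / 4) / (1 - 3 / 4) = 3 ∧ 2 * (1 : ℝ) / 1 * (3 / 4) = 3 / 2 := by norm_num

end Arith

end Summit.QuantumFields.BalabanUV.T4Continuum.NE1p.DressedRegenerationLinear

end
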